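import Summits.QuantumFields.YangMills.Theorems.RationalShortRootRigidityWeightedIndependence
import HarnessLib

/-!
# `RationalShortRootRigidity` — Step 2 assembly helper (§C/(DEG) of the `stub_planar` plan): the support bound

Helper lemma INSIDE the paper proof of crux `stmt-QuantumFields-23124` (`F4SubCurvatureDoor.RationalShortRootRigidity`,
LINE g15-A of planner ym-idea-3; owner's assembly plan HOME l15/STUB-PLAN-Planar.md §C and (DEG) in §E):

**Lemma** (`support_bound_of_topForm`).  Let `b(x,y) = Σ_{(i,j)∈S} c_ij u₂^i u₃^j` (`u₂ = x²+y²`, `u₃ = 3x²y − y³`, all `c_ij ≠ 0`) with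
`totalDegree b ≤ 2k`, and suppose the top form of `b` is `c'·(x²+y²)^k` with `c' ≠ 0` (the output of `mobiusTopForm`).  Then
`(k,0) ∈ S`, `c_(k,0) = c'`, and every other `(i,j) ∈ S` has `2i + 3j ≤ 2k − 1` — the support hypotheses of `noU3Lemma` (p668537).

Proof.  `u₂^i u₃^j` is homogeneous of degree `2i+3j`, so the degree-`w` component of `b` is the weight-`w` part of the sum
(`eval_homogeneousComponent_weightSum`); components above `totalDegree` vanish, and the top one is `c' u₂^k`; conclude with
`weighted_independence` (p671414).

Mathlib + the tree lemma `weighted_independence`; THEOREMS ONLY; no named facts; no `sorry`; default heartbeats.  Nothing about the crux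
23124, the route's rung or the Yang–Mills mass gap is proved here.  Free-hands seat `ym-line-frs-p2` g10, `--supports stmt-QuantumFields-23124`.
-/

set_option autoImplicit false

namespace Summit.QuantumFields.YangMills.Theorems.RationalShortRootRigidity

open scoped BigOperators

/-- Homogeneous components of a weighted sum `Σ c_ij u₂^i u₃^j`: the degree-`w` component is the weight-`w` part. [folklore] -/
theorem eval_homogeneousComponent_weightSum (S : Finset (ℕ × ℕ)) (cf : ℕ × ℕ → ℝ) (b : MvPolynomial (Fin 2) ℝ)
    (hb : ∀ v : Fin 2 → ℝ, MvPolynomial.eval v b =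
      ∑ ij ∈ S, cf ij * (v 0 ^ 2 + v 1 ^ 2) ^ ij.1 * (3 * v 0 ^ 2 * v 1 - v 1 ^ 3) ^ ij.2) (w : ℕ) :
    ∀ v : Fin 2 → ℝ, MvPolynomial.eval v (MvPolynomial.homogeneousComponent w b) =
      ∑ ij ∈ S with 2 * ij.1 + 3 * ij.2 = w, cf ij * (v 0 ^ 2 + v 1 ^ 2) ^ ij.1 * (3 * v 0 ^ 2 * v 1 - v 1 ^ 3) ^ ij.2 := by
  classical
  set u2 : MvPolynomial (Fin 2) ℝ := MvPolynomial.X 0 ^ 2 + MvPolynomial.X 1 ^ 2 with hu2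
  set u3 : MvPolynomial (Fin 2) ℝ := MvPolynomial.C 3 * MvPolynomial.X 0 ^ 2 * MvPolynomial.X 1 - MvPolynomial.X 1 ^ 3 with hu3
  have hu2h : u2.IsHomogeneous 2 := (MvPolynomial.isHomogeneous_X_pow 0 2).add (MvPolynomial.isHomogeneous_X_pow 1 2)
  have hu3h : u3.IsHomogeneous 3 :=
    (((MvPolynomial.isHomogeneous_X_pow (R := ℝ) 0 2).C_mul 3).mul (MvPolynomial.isHomogeneous_X ℝ 1)).sub
      (MvPolynomial.isHomogeneous_X_pow 1 3)
  have hu2e : ∀ v : Fin 2 → ℝ, MvPolynomial.eval v u2 = v 0 ^ 2 + v 1 ^ 2 := fun v => by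
    simp only [hu2, map_add, map_pow, MvPolynomial.eval_X]
  have hu3e : ∀ v : Fin 2 → ℝ, MvPolynomial.eval v u3 = 3 * v 0 ^ 2 * v 1 - v 1 ^ 3 := fun v => by
    simp only [hu3, map_sub, map_mul, map_pow, MvPolynomial.eval_X, MvPolynomial.eval_C]
  -- `b` as a polynomial in `u₂, u₃`
  have hbpoly : b = ∑ ij ∈ S, MvPolynomial.C (cf ij) * u2 ^ ij.1 * u3 ^ ij.2 := by
    apply MvPolynomial.funext
    intro v
    rw [hb v, map_sum]
    refine Finset.sum_congr rfl fun ij _ => ?_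
    rw [map_mul, map_mul, MvPolynomial.eval_C, map_pow, map_pow, hu2e, hu3e]
  have hterm : ∀ ij : ℕ × ℕ, MvPolynomial.homogeneousComponent w (MvPolynomial.C (cf ij) * u2 ^ ij.1 * u3 ^ ij.2) =
      if w = 2 * ij.1 + 3 * ij.2 then MvPolynomial.C (cf ij) * u2 ^ ij.1 * u3 ^ ij.2 else 0 := by
    intro ij
    exact MvPolynomial.homogeneousComponent_of_mem (((hu2h.pow ij.1).C_mul (cf ij)).mul (hu3h.pow ij.2))
  intro v
  rw [hbpoly, map_sum]
  simp_rw [hterm]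
  rw [map_sum, Finset.sum_filter]
  refine Finset.sum_congr rfl fun ij _ => ?_
  by_cases h : 2 * ij.1 + 3 * ij.2 = w
  · rw [if_pos h, if_pos h.symm, map_mul, map_mul, MvPolynomial.eval_C, map_pow, map_pow, hu2e, hu3e]
  · rw [if_neg h, if_neg (fun h' => h h'.symm), map_zero]

/-- **Support bound from the top form** (STUB-PLAN-Planar (DEG)): the hypotheses of `noU3Lemma` for the Chevalley polynomial. [folklore] -/
theorem support_bound_of_topForm (S : Finset (ℕ × ℕ)) (cf : ℕ × ℕ → ℝ) (hcf : ∀ ij ∈ S, cf ij ≠ 0)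
    (b : MvPolynomial (Fin 2) ℝ) (k : ℕ) (hdeg : b.totalDegree ≤ 2 * k)
    (hb : ∀ v : Fin 2 → ℝ, MvPolynomial.eval v b =
      ∑ ij ∈ S, cf ij * (v 0 ^ 2 + v 1 ^ 2) ^ ij.1 * (3 * v 0 ^ 2 * v 1 - v 1 ^ 3) ^ ij.2)
    (c' : ℝ) (hc' : c' ≠ 0)
    (htop : ∀ v : Fin 2 → ℝ, MvPolynomial.eval v (MvPolynomial.homogeneousComponent (2 * k) b) = c' * (v 0 ^ 2 + v 1 ^ 2) ^ k) :
    (k, 0) ∈ S ∧ cf (k, 0) = c' ∧ ∀ ij ∈ S, ij ≠ (k, 0) → 2 * ij.1 + 3 * ij.2 + 1 ≤ 2 * k := by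
  classical
  have hcomp := eval_homogeneousComponent_weightSum S cf b hb
  -- no weight above `2k`
  have habove : ∀ ij ∈ S, 2 * ij.1 + 3 * ij.2 ≤ 2 * k := by
    intro ij hij
    by_contra hgt
    rw [not_le] at hgt
    set w := 2 * ij.1 + 3 * ij.2 with hw
    have hzero : MvPolynomial.homogeneousComponent w b = 0 :=
      MvPolynomial.homogeneousComponent_eq_zero _ _ (lt_of_le_of_lt hdeg hgt)
    have hind := weighted_independence w (S.filter (fun ij => 2 * ij.1 + 3 * ij.2 = w)) cf
      (fun ij' h' => (Finset.mem_filter.1 h').2) (fun x y => by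
        have h1 := hcomp w (fun i => if i = 0 then x else y)
        rw [hzero, map_zero] at h1
        simp only [if_true, show (1 : Fin 2) ≠ 0 by decide, if_false] at h1
        exact h1.symm)
    exact hcf ij hij (hind ij (Finset.mem_filter.2 ⟨hij, rfl⟩))
  -- the top weight: only `(k,0)`, with coefficient `c'`
  set F : Finset (ℕ × ℕ) := insert (k, 0) (S.filter (fun ij => 2 * ij.1 + 3 * ij.2 = 2 * k)) with hF
  set a : ℕ × ℕ → ℝ := fun ij => (if ij ∈ S.filter (fun ij => 2 * ij.1 + 3 * ij.2 = 2 * k) then cf ij else 0) -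
    (if ij = (k, 0) then c' else 0) with ha
  have hFw : ∀ ij ∈ F, 2 * ij.1 + 3 * ij.2 = 2 * k := by
    intro ij hij
    rw [hF, Finset.mem_insert] at hij
    rcases hij with rfl | hij
    · simp
    · exact (Finset.mem_filter.1 hij).2
  have hsumF : ∀ x y : ℝ, (∑ ij ∈ F, a ij * (x ^ 2 + y ^ 2) ^ ij.1 * (3 * x ^ 2 * y - y ^ 3) ^ ij.2) = 0 := by
    intro x y
    have h1 := hcomp (2 * k) (fun i => if i = 0 then x else y)
    rw [htop] at h1
    simp only [if_true, show (1 : Fin 2) ≠ 0 by decide, if_false] at h1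
    -- split `a`
    have hsplit : ∀ ij ∈ F, a ij * (x ^ 2 + y ^ 2) ^ ij.1 * (3 * x ^ 2 * y - y ^ 3) ^ ij.2 =
        (if ij ∈ S.filter (fun ij => 2 * ij.1 + 3 * ij.2 = 2 * k) then
          cf ij * (x ^ 2 + y ^ 2) ^ ij.1 * (3 * x ^ 2 * y - y ^ 3) ^ ij.2 else 0) -
        (if ij = (k, 0) then c' * (x ^ 2 + y ^ 2) ^ ij.1 * (3 * x ^ 2 * y - y ^ 3) ^ ij.2 else 0) := by
      intro ij _
      by_cases h1 : ij ∈ S.filter (fun ij => 2 * ij.1 + 3 * ij.2 = 2 * k)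
      · by_cases h2 : ij = (k, 0)
        · subst h2; simp only [ha, h1, if_true]; ring
        · simp only [ha, h1, h2, if_true, if_false]; ring
      · by_cases h2 : ij = (k, 0)
        · subst h2; simp only [ha, h1, if_true, if_false]; ring
        · simp only [ha, h1, h2, if_false]; ring
    rw [Finset.sum_congr rfl hsplit, Finset.sum_sub_distrib, ← Finset.sum_filter, ← Finset.sum_filter]
    have hf1 : F.filter (fun ij => ij ∈ S.filter (fun ij => 2 * ij.1 + 3 * ij.2 = 2 * k)) =
        S.filter (fun ij => 2 * ij.1 + 3 * ij.2 = 2 * k) := by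
      ext ij
      simp only [Finset.mem_filter, hF, Finset.mem_insert]
      tauto
    have hf2 : F.filter (fun ij => ij = (k, 0)) = {(k, 0)} := by
      ext ij
      simp only [Finset.mem_filter, hF, Finset.mem_insert, Finset.mem_singleton]
      tauto
    rw [hf1, hf2, Finset.sum_singleton, ← h1]
    simp
  have hind := weighted_independence (2 * k) F a hFw hsumF
  have hk0F : (k, 0) ∈ F := by rw [hF]; exact Finset.mem_insert_self _ _
  have hak : a (k, 0) = 0 := hind _ hk0F
  rw [ha] at hak
  simp only [if_true] at hak
  have hk0S : (k, 0) ∈ S.filter (fun ij => 2 * ij.1 + 3 * ij.2 = 2 * k) := by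
    by_contra h
    rw [if_neg h] at hak
    exact hc' (by linarith)
  rw [if_pos hk0S] at hak
  refine ⟨(Finset.mem_filter.1 hk0S).1, by linarith, fun ij hij hne => ?_⟩
  have hle := habove ij hij
  rcases Nat.lt_or_ge (2 * ij.1 + 3 * ij.2) (2 * k) with hlt | hge
  · omega
  · exfalso
    have heq : 2 * ij.1 + 3 * ij.2 = 2 * k := le_antisymm hle hge
    have hmem : ij ∈ S.filter (fun ij => 2 * ij.1 + 3 * ij.2 = 2 * k) := Finset.mem_filter.2 ⟨hij, heq⟩
    have hijF : ij ∈ F := by rw [hF]; exact Finset.mem_insert_of_mem hmem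
    have := hind ij hijF
    rw [ha] at this
    simp only [hmem, if_true, hne, if_false, sub_zero] at this
    exact hcf ij hij this

end Summit.QuantumFields.YangMills.Theorems.RationalShortRootRigidity
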